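import Summits.QuantumFields.YangMills.Theorems.ColdStartUniversalityLatticeLangevinHopfLaxEntropy
import HarnessLib

/-!
# HYPERCONTRACTIVITY OF THE HOPF–LAX SEMIGROUP FROM A LOG-SOBOLEV INEQUALITY (Bobkov–Gentil–Ledoux / Bakry–Gentil–Ledoux Thm 9.5.1) on a compact
# metric probability space, and the dual form of Talagrand's `T₂`: `∫ e^{Q_C f} dμ ≤ e^{∫ f dμ}` (Otto–Villani, BGL Thm 9.6.1)

Seat `ym-line-csu-p1` (g42), route `ColdStartUniversality` of `Summits/QuantumFields/YangMills`, helper file G69b (`--supports stmt-QuantumFields-24809`).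
GENERIC (any compact metric space `X`, Borel probability measure `μ`; instantiated in the sequel with `X = SU(2)^E`, `ρ_L`, `μ = μ_(β')`).
The log-Sobolev inequality is taken in the form adapted to Lipschitz functions with LOCAL Lipschitz majorants (the form the tree can supply by
mollification, cf. G63c): `Ent_μ(e^F) ≤ (C/2)·∫G²e^F dμ` whenever `F` is `G(w)`-Lipschitz on each ball `B̄(w,R)`.  The Hamilton–Jacobi structure
of the Hopf–Lax semigroup enters through G62 (time inequality `Q_{t'}f ≤ Q_tf − δD_t⁺²/(2tt')`, slope majorants `(sup_{B̄(w,R)}D_t⁺ + R)/t`), exactly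
as in Kuwada's duality (G64a): along `q(t) = a + t/C` the functional `H(t) = q(t)⁻¹ log ∫e^{q(t)Q_tf}dμ` has `O(δ²)` increments, hence is non-increasing.

PART II (this file, G69b): `exp_step_pointwise` (`e^{u'} ≤ e^u(1+h) + E₀h₀²δ²`), `laplace_step_algebra` (the scalar bookkeeping, pure real arithmetic),
★★ `hopfLax_laplace_step` — `q(t')⁻¹log∫e^{q(t')Q_{t'}f} − q(t)⁻¹log∫e^{q(t)Q_tf} ≤ K·(t'−t)²` for `t₀ ≤ t ≤ t' ≤ T`, `t' − t` small (Part I supplies the LSI at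
the exact slope).  Part III (sequel): monotonicity, `∫e^{Q_C f}dμ ≤ e^{∫f dμ}` and Talagrand's `T₂`.

THEOREMS ONLY, no definition, no sorry.  HONEST FRAMING: abstract metric-measure lemmas; nothing here is specific to Yang–Mills; no crux, rung or
summit statement is proved; the Yang–Mills mass gap is NOT proved.
-/

set_option autoImplicit false

noncomputable section

namespace Summit.QuantumFields.YangMills.Theorems.ColdStartUniversality

open MeasureTheory ProbabilityTheory Filter Topology Set Metric
open scoped BigOperators

variable {X : Type*} [MetricSpace X] [CompactSpace X] [MeasurableSpace X] [BorelSpace X]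

/-! ## §3. The step estimate for `H(t) = q(t)⁻¹ log ∫ e^{q(t)Q_tf} dμ`, `q(t) = a + t/C` -/

/-- Pointwise exponential step: if `u' ≤ u + h`, `|h| ≤ δh₀ ≤ 1` and `e^u ≤ E₀`, then `e^{u'} ≤ e^u(1 + h) + E₀h₀²δ²`
(`|e^h − 1 − h| ≤ h²` for `|h| ≤ 1`). [folklore] -/
theorem exp_step_pointwise {u u' h δ h₀ E₀ : ℝ} (hu : u' ≤ u + h) (hh : |h| ≤ δ * h₀) (hδh : δ * h₀ ≤ 1) (hE : Real.exp u ≤ E₀) :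
    Real.exp u' ≤ Real.exp u * (1 + h) + E₀ * (h₀ ^ 2 * δ ^ 2) := by
  have hh1 : |h| ≤ 1 := hh.trans hδh
  have hT := Real.abs_exp_sub_one_sub_id_le hh1
  have hT' : Real.exp h ≤ 1 + h + (δ * h₀) ^ 2 := by
    have h1 := (abs_le.1 hT).2
    have h2 : h ^ 2 ≤ (δ * h₀) ^ 2 := by rw [← sq_abs]; exact pow_le_pow_left₀ (abs_nonneg _) hh 2
    linarith
  have hpos : 0 ≤ h₀ ^ 2 * δ ^ 2 := by positivity
  calc Real.exp u' ≤ Real.exp (u + h) := Real.exp_le_exp.2 hu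
    _ = Real.exp u * Real.exp h := Real.exp_add _ _
    _ ≤ Real.exp u * (1 + h + (δ * h₀) ^ 2) := mul_le_mul_of_nonneg_left hT' (Real.exp_pos _).le
    _ = Real.exp u * (1 + h) + Real.exp u * (h₀ ^ 2 * δ ^ 2) := by ring
    _ ≤ Real.exp u * (1 + h) + E₀ * (h₀ ^ 2 * δ ^ 2) := by gcongr

/-- The scalar bookkeeping of the step estimate (pure real arithmetic): from the integrated exponential step, the log-Sobolev inequality at the
exact slope and the a-priori bounds, `q'⁻¹ log Λ' − q⁻¹ log Λ ≤ δ²·(2L²/t₀ + E₀²h₀²/a)`. [cite: BakryGentilLedoux2014, Thm 9.5.1] -/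
theorem laplace_step_algebra {a C t t' t₀ Lf q q' δ h₀ E₀ Λ Λ' A B : ℝ} (hC : 0 < C) (ha : 0 < a) (ht₀ : 0 < t₀) (ht₀t : t₀ ≤ t)
    (htt' : t ≤ t') (hq : q = a + t / C) (hq' : q' = a + t' / C) (hδ : δ = t' - t) (hE₀ : 0 < E₀) (hΛge : E₀⁻¹ ≤ Λ)
    (hΛ'0 : 0 < Λ') (hB0 : 0 ≤ B) (hBle : B ≤ (2 * t * Lf) ^ 2 * Λ)
    (hΛ'le : Λ' ≤ Λ + (δ / C) * A - (q' * δ / (2 * t * t')) * B + E₀ * (h₀ ^ 2 * δ ^ 2)) (hLSI : A - Λ / q * Real.log Λ ≤ C * q / (2 * t ^ 2) * B) :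
    1 / q' * Real.log Λ' - 1 / q * Real.log Λ ≤ δ ^ 2 * (2 * Lf ^ 2 / t₀ + E₀ * E₀ * h₀ ^ 2 / a) := by
  have ht : 0 < t := lt_of_lt_of_le ht₀ ht₀t
  have ht' : 0 < t' := lt_of_lt_of_le ht htt'
  have hδ0 : 0 ≤ δ := by rw [hδ]; linarith
  have hqq' : q' - q = δ / C := by rw [hq, hq', hδ]; ring
  have hqa : a ≤ q := by rw [hq]; have : 0 ≤ t / C := div_nonneg ht.le hC.le; linarith
  have hq0 : 0 < q := lt_of_lt_of_le ha hqa
  have hq'a : a ≤ q' := by rw [hq']; have : 0 ≤ t' / C := div_nonneg ht'.le hC.le; linarith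
  have hq'0 : 0 < q' := lt_of_lt_of_le ha hq'a
  have hΛ0 : 0 < Λ := lt_of_lt_of_le (inv_pos.2 hE₀) hΛge
  have hB0' : B / Λ ≤ (2 * t * Lf) ^ 2 := (div_le_iff₀ hΛ0).2 hBle
  have hBΛ0 : 0 ≤ B / Λ := div_nonneg hB0 hΛ0.le
  -- concavity of `log`
  have hlog : Real.log Λ' - Real.log Λ ≤ (Λ' - Λ) / Λ := by
    have h := Real.log_le_sub_one_of_pos (div_pos hΛ'0 hΛ0)
    rw [Real.log_div hΛ'0.ne' hΛ0.ne'] at h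
    have e : Λ' / Λ - 1 = (Λ' - Λ) / Λ := by field_simp
    linarith [e.symm.le, e.le]
  -- the increment
  have e1 : 1 / q' * Real.log Λ' - 1 / q * Real.log Λ = 1 / q' * (Real.log Λ' - Real.log Λ) - (δ / (C * q * q')) * Real.log Λ := by
    have : 1 / q' - 1 / q = -(δ / (C * q * q')) := by
      rw [show δ / (C * q * q') = (q' - q) / (q * q') by rw [hqq']; field_simp]
      field_simp
      ring
    calc 1 / q' * Real.log Λ' - 1 / q * Real.log Λ = 1 / q' * (Real.log Λ' - Real.log Λ) + (1 / q' - 1 / q) * Real.log Λ := by ring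
      _ = _ := by rw [this]; ring
  have h2 : 1 / q' * (Real.log Λ' - Real.log Λ) ≤ 1 / q' * (((δ / C) * A - (q' * δ / (2 * t * t')) * B + E₀ * (h₀ ^ 2 * δ ^ 2)) / Λ) := by
    refine mul_le_mul_of_nonneg_left (hlog.trans ?_) (by positivity)
    exact div_le_div_of_nonneg_right (by linarith) hΛ0.le
  have e4 : 1 / q' * (((δ / C) * A - (q' * δ / (2 * t * t')) * B + E₀ * (h₀ ^ 2 * δ ^ 2)) / Λ) - δ / (C * q * q') * Real.log Λ =
      δ / (C * q' * Λ) * (A - Λ / q * Real.log Λ) - δ / (2 * t * t' * Λ) * B + E₀ * (h₀ ^ 2 * δ ^ 2) / (q' * Λ) := by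
    field_simp; ring
  have hinc : 1 / q' * Real.log Λ' - 1 / q * Real.log Λ ≤
      δ / (C * q' * Λ) * (A - Λ / q * Real.log Λ) - δ / (2 * t * t' * Λ) * B + E₀ * (h₀ ^ 2 * δ ^ 2) / (q' * Λ) := by
    rw [e1, ← e4]; linarith
  -- first term: `≤ δ²·2L²/t₀`
  have hT1 : δ / (C * q' * Λ) * (A - Λ / q * Real.log Λ) - δ / (2 * t * t' * Λ) * B ≤ δ ^ 2 * (2 * Lf ^ 2 / t₀) := by
    have h1 : δ / (C * q' * Λ) * (A - Λ / q * Real.log Λ) ≤ δ / (C * q' * Λ) * (C * q / (2 * t ^ 2) * B) :=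
      mul_le_mul_of_nonneg_left hLSI (by positivity)
    have e2 : δ / (C * q' * Λ) * (C * q / (2 * t ^ 2) * B) - δ / (2 * t * t' * Λ) * B = δ * (B / Λ) * ((q * t' - q' * t) / (2 * q' * t ^ 2 * t')) := by
      field_simp
    have e3 : q * t' - q' * t = δ * a := by rw [hq, hq', hδ]; field_simp; ring
    have h4 : δ * (B / Λ) * ((q * t' - q' * t) / (2 * q' * t ^ 2 * t')) ≤ δ ^ 2 * (2 * Lf ^ 2 / t₀) := by
      rw [e3]
      have haq : a / q' ≤ 1 := (div_le_one hq'0).2 hq'a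
      have e : δ * (B / Λ) * (δ * a / (2 * q' * t ^ 2 * t')) = δ ^ 2 * ((B / Λ) * (a / q')) / (2 * t ^ 2 * t') := by
        field_simp
      rw [e, div_le_iff₀ (by positivity)]
      have h5 : (B / Λ) * (a / q') ≤ (2 * t * Lf) ^ 2 * 1 := mul_le_mul hB0' haq (div_nonneg ha.le hq'0.le) (sq_nonneg _)
      have h6 : δ ^ 2 * ((B / Λ) * (a / q')) ≤ δ ^ 2 * (2 * t * Lf) ^ 2 :=
        mul_le_mul_of_nonneg_left (by rw [mul_one] at h5; exact h5) (sq_nonneg δ)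
      have h7 : δ ^ 2 * (2 * t * Lf) ^ 2 ≤ δ ^ 2 * (2 * Lf ^ 2 / t₀) * (2 * t ^ 2 * t') := by
        rw [show δ ^ 2 * (2 * Lf ^ 2 / t₀) * (2 * t ^ 2 * t') = δ ^ 2 * (2 * t * Lf) ^ 2 * (t' / t₀) by field_simp]
        have ht't₀ : 1 ≤ t' / t₀ := (one_le_div ht₀).2 (ht₀t.trans htt')
        have h0 : 0 ≤ δ ^ 2 * (2 * t * Lf) ^ 2 := by positivity
        exact le_mul_of_one_le_right h0 ht't₀
      exact h6.trans h7
    linarith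
  -- second term: `≤ δ²·E₀²h₀²/a`
  have hT2 : E₀ * (h₀ ^ 2 * δ ^ 2) / (q' * Λ) ≤ δ ^ 2 * (E₀ * E₀ * h₀ ^ 2 / a) := by
    rw [div_le_iff₀ (by positivity)]
    have h1 : 1 ≤ E₀ * Λ := by
      have := mul_le_mul_of_nonneg_left hΛge hE₀.le
      rwa [mul_inv_cancel₀ hE₀.ne'] at this
    have h3 : 0 ≤ E₀ * (h₀ ^ 2 * δ ^ 2) := by positivity
    calc E₀ * (h₀ ^ 2 * δ ^ 2) = E₀ * (h₀ ^ 2 * δ ^ 2) * 1 * (a / a) := by field_simp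
      _ ≤ E₀ * (h₀ ^ 2 * δ ^ 2) * (E₀ * Λ) * (q' / a) := by
          refine mul_le_mul (mul_le_mul_of_nonneg_left h1 h3) (div_le_div_of_nonneg_right hq'a ha.le) (by positivity) (by positivity)
      _ = δ ^ 2 * (E₀ * E₀ * h₀ ^ 2 / a) * (q' * Λ) := by field_simp
  linarith

/-- ★★ **Hypercontractivity of Hopf–Lax, one step.**  Under the local-majorant LSI with constant `C > 0`: for continuous `L_f`-Lipschitz `f` with
`|f| ≤ M_f`, `a > 0`, `0 < t₀ ≤ t ≤ t' ≤ T` and `(t' − t)·(h₀ + 1) ≤ 1`, `h₀ = M_f/C + 2(a + T/C)L_f²`: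
`q(t')⁻¹ log ∫e^{q(t')Q_{t'}f}dμ − q(t)⁻¹ log ∫e^{q(t)Q_tf}dμ ≤ (t' − t)²·(2L_f²/t₀ + e^{(a+T/C)M_f}·e^{(a+T/C)M_f}·h₀²/a)`, `q(s) = a + s/C`.
[cite: BakryGentilLedoux2014, Thm 9.5.1] -/
theorem hopfLax_laplace_step (μ : Measure X) [IsProbabilityMeasure μ] {C : ℝ} (hC : 0 < C)
    (hLS : ∀ (F : X → ℝ) (Lf : ℝ), 0 ≤ Lf → (∀ z z' : X, |F z' - F z| ≤ Lf * dist z z') → ∀ (R : ℝ), 0 < R →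
      ∀ (G : X → ℝ) (M : ℝ), UpperSemicontinuous G → (∀ w, 0 ≤ G w) → (∀ w, G w ≤ M) →
      (∀ w z' z'' : X, dist w z' ≤ R → dist w z'' ≤ R → |F z'' - F z'| ≤ G w * dist z' z'') →
      ∫ x, F x * Real.exp (F x) ∂μ - (∫ x, Real.exp (F x) ∂μ) * Real.log (∫ x, Real.exp (F x) ∂μ) ≤ C / 2 * ∫ x, G x ^ 2 * Real.exp (F x) ∂μ)
    {f : X → ℝ} (hf : Continuous f) {Lf : ℝ} (hLf : 0 ≤ Lf) (hlip : ∀ z w, |f z - f w| ≤ Lf * dist z w) {Mf : ℝ} (hMf : ∀ z, |f z| ≤ Mf)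
    {a t₀ T t t' : ℝ} (ha : 0 < a) (ht₀ : 0 < t₀) (ht₀t : t₀ ≤ t) (htt' : t ≤ t') (ht'T : t' ≤ T)
    (hsmall : (t' - t) * (Mf / C + 2 * (a + T / C) * Lf ^ 2 + 1) ≤ 1) :
    1 / (a + t' / C) * Real.log (∫ x, Real.exp ((a + t' / C) * ⨅ v, (f v + dist x v ^ 2 / (2 * t'))) ∂μ) -
        1 / (a + t / C) * Real.log (∫ x, Real.exp ((a + t / C) * ⨅ v, (f v + dist x v ^ 2 / (2 * t))) ∂μ) ≤
      (t' - t) ^ 2 * (2 * Lf ^ 2 / t₀ + Real.exp ((a + T / C) * Mf) * Real.exp ((a + T / C) * Mf) * (Mf / C + 2 * (a + T / C) * Lf ^ 2) ^ 2 / a) := by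
  have ht : 0 < t := lt_of_lt_of_le ht₀ ht₀t
  have ht' : 0 < t' := lt_of_lt_of_le ht htt'
  have hne : Nonempty X := by
    by_contra hX
    rw [not_nonempty_iff] at hX
    have h1 := measure_univ (μ := μ)
    rw [Set.univ_eq_empty_iff.mpr hX, measure_empty] at h1
    exact zero_ne_one h1
  have hMf0 : 0 ≤ Mf := (abs_nonneg _).trans (hMf (Classical.arbitrary X))
  -- names
  obtain ⟨Q, hQ⟩ : ∃ Q : X → ℝ, Q = fun x => ⨅ v, (f v + dist x v ^ 2 / (2 * t)) := ⟨_, rfl⟩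
  obtain ⟨Q', hQ'⟩ : ∃ Q' : X → ℝ, Q' = fun x => ⨅ v, (f v + dist x v ^ 2 / (2 * t')) := ⟨_, rfl⟩
  obtain ⟨D, hD⟩ : ∃ D : X → ℝ, D = fun x => sSup ((fun v => dist x v) '' {v | ∀ v' : X, f v + dist x v ^ 2 / (2 * t) ≤ f v' + dist x v' ^ 2 / (2 * t)}) := ⟨_, rfl⟩
  obtain ⟨q, hq⟩ : ∃ q : ℝ, q = a + t / C := ⟨_, rfl⟩
  obtain ⟨q', hq'⟩ : ∃ q' : ℝ, q' = a + t' / C := ⟨_, rfl⟩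
  obtain ⟨qT, hqT⟩ : ∃ qT : ℝ, qT = a + T / C := ⟨_, rfl⟩
  obtain ⟨δ, hδ⟩ : ∃ δ : ℝ, δ = t' - t := ⟨_, rfl⟩
  obtain ⟨h₀, hh₀⟩ : ∃ h₀ : ℝ, h₀ = Mf / C + 2 * qT * Lf ^ 2 := ⟨_, rfl⟩
  obtain ⟨E₀, hE₀⟩ : ∃ E₀ : ℝ, E₀ = Real.exp (qT * Mf) := ⟨_, rfl⟩
  have hQw : ∀ w, Q w = ⨅ v, (f v + dist w v ^ 2 / (2 * t)) := fun w => by rw [hQ]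
  have hQ'w : ∀ w, Q' w = ⨅ v, (f v + dist w v ^ 2 / (2 * t')) := fun w => by rw [hQ']
  have hDw : ∀ w, D w = sSup ((fun v => dist w v) '' {v | ∀ v' : X, f v + dist w v ^ 2 / (2 * t) ≤ f v' + dist w v' ^ 2 / (2 * t)}) := fun w => by rw [hD]
  have hgoal : 1 / q' * Real.log (∫ x, Real.exp (q' * Q' x) ∂μ) - 1 / q * Real.log (∫ x, Real.exp (q * Q x) ∂μ) ≤
      δ ^ 2 * (2 * Lf ^ 2 / t₀ + E₀ * E₀ * h₀ ^ 2 / a) := by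
    -- scalar facts
    have hδ0 : 0 ≤ δ := by rw [hδ]; linarith
    have hqa : a ≤ q := by rw [hq]; have : 0 ≤ t / C := div_nonneg ht.le hC.le; linarith
    have hq0 : 0 < q := lt_of_lt_of_le ha hqa
    have hq'a : a ≤ q' := by rw [hq']; have : 0 ≤ t' / C := div_nonneg ht'.le hC.le; linarith
    have hq'0 : 0 < q' := lt_of_lt_of_le ha hq'a
    have hqle : q ≤ q' := by rw [hq, hq']; have := div_le_div_of_nonneg_right htt' hC.le; linarith
    have hq'T : q' ≤ qT := by rw [hq', hqT]; have := div_le_div_of_nonneg_right ht'T hC.le; linarith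
    have hh₀0 : 0 ≤ h₀ := by rw [hh₀]; have : 0 < qT := lt_of_lt_of_le hq'0 hq'T; positivity
    have hδh : δ * h₀ ≤ 1 := by
      have h2 : δ * (h₀ + 1) ≤ 1 := by rw [hδ, hh₀, hqT]; exact hsmall
      nlinarith
    -- bounds on `Q`, `Q'`, `D`
    have hQle : ∀ x, Q x ≤ Mf := fun x => by rw [hQw]; exact (hopfLax_le_self hf t x).trans (le_abs_self _ |>.trans (hMf x))
    have hQge : ∀ x, -Mf ≤ Q x := fun x => by
      obtain ⟨w, hw, -⟩ := hopfLax_exists_farthest hf t x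
      rw [hQw, hopfLax_eq_of_isMinOn hf hw]
      have h1 : -Mf ≤ f w := by have := hMf w; rw [abs_le] at this; exact this.1
      have h2 : 0 ≤ dist x w ^ 2 / (2 * t) := by positivity
      linarith
    have hQ'ge : ∀ x, -Mf ≤ Q' x := fun x => by
      obtain ⟨w, hw, -⟩ := hopfLax_exists_farthest hf t' x
      rw [hQ'w, hopfLax_eq_of_isMinOn hf hw]
      have h1 : -Mf ≤ f w := by have := hMf w; rw [abs_le] at this; exact this.1
      have h2 : 0 ≤ dist x w ^ 2 / (2 * t') := by positivity
      linarith
    have hD0 : ∀ w, 0 ≤ D w := fun w => by rw [hDw]; exact hopfLaxFar_nonneg hf t w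
    have hDle : ∀ w, D w ≤ 2 * t * Lf := fun w => by rw [hDw]; exact hopfLaxFar_le hf hLf hlip ht w
    have hDusc : UpperSemicontinuous D := by rw [hD]; exact hopfLaxFar_upperSemicontinuous hf t
    have hQc : Continuous Q := by rw [hQ]; exact hopfLax_continuous hf hLf hlip ht
    have hQ'c : Continuous Q' := by rw [hQ']; exact hopfLax_continuous hf hLf hlip ht'
    -- the exponential weights
    have hE₀0 : 0 < E₀ := by rw [hE₀]; exact Real.exp_pos _
    have hexp_le : ∀ x, Real.exp (q * Q x) ≤ E₀ := fun x => by
      rw [hE₀]; refine Real.exp_le_exp.2 ?_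
      calc q * Q x ≤ q * Mf := mul_le_mul_of_nonneg_left (hQle x) hq0.le
        _ ≤ qT * Mf := mul_le_mul_of_nonneg_right (hqle.trans hq'T) hMf0
    have hexp_ge : ∀ x, E₀⁻¹ ≤ Real.exp (q * Q x) := fun x => by
      rw [hE₀, ← Real.exp_neg]; refine Real.exp_le_exp.2 ?_
      have h1 : q * (-Mf) ≤ q * Q x := mul_le_mul_of_nonneg_left (hQge x) hq0.le
      have h2 : q * Mf ≤ qT * Mf := mul_le_mul_of_nonneg_right (hqle.trans hq'T) hMf0
      linarith
    -- integrability
    have hEc : Continuous fun x => Real.exp (q * Q x) := Real.continuous_exp.comp (continuous_const.mul hQc)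
    have hE'c : Continuous fun x => Real.exp (q' * Q' x) := Real.continuous_exp.comp (continuous_const.mul hQ'c)
    have hEi : Integrable (fun x => Real.exp (q * Q x)) μ := hEc.integrable_of_hasCompactSupport (HasCompactSupport.of_compactSpace _)
    have hE'i : Integrable (fun x => Real.exp (q' * Q' x)) μ := hE'c.integrable_of_hasCompactSupport (HasCompactSupport.of_compactSpace _)
    have hAi : Integrable (fun x => Q x * Real.exp (q * Q x)) μ := (hQc.mul hEc).integrable_of_hasCompactSupport (HasCompactSupport.of_compactSpace _)
    have hD2m : Measurable fun x => D x ^ 2 * Real.exp (q * Q x) := (hDusc.measurable.pow_const 2).mul hEc.measurable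
    have hBi : Integrable (fun x => D x ^ 2 * Real.exp (q * Q x)) μ :=
      (memLp_of_bounded (a := 0) (b := (2 * t * Lf) ^ 2 * E₀) (ae_of_all _ fun x => ⟨mul_nonneg (sq_nonneg _) (Real.exp_pos _).le,
        mul_le_mul (pow_le_pow_left₀ (hD0 x) (hDle x) 2) (hexp_le x) (Real.exp_pos _).le (sq_nonneg _)⟩) hD2m.aestronglyMeasurable 1).integrable le_rfl
    have hhm : Integrable (fun x => Real.exp (q * Q x) * (1 + ((δ / C) * Q x - q' * δ * D x ^ 2 / (2 * t * t')))) μ := by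
      have e : (fun x => Real.exp (q * Q x) * (1 + ((δ / C) * Q x - q' * δ * D x ^ 2 / (2 * t * t')))) =
          fun x => Real.exp (q * Q x) + (δ / C) * (Q x * Real.exp (q * Q x)) - (q' * δ / (2 * t * t')) * (D x ^ 2 * Real.exp (q * Q x)) := by
        funext x; ring
      rw [e]
      exact (hEi.add (hAi.const_mul _)).sub (hBi.const_mul _)
    -- the integrals
    obtain ⟨Λ, hΛ⟩ : ∃ Λ : ℝ, Λ = ∫ x, Real.exp (q * Q x) ∂μ := ⟨_, rfl⟩
    obtain ⟨Λ', hΛ'⟩ : ∃ Λ' : ℝ, Λ' = ∫ x, Real.exp (q' * Q' x) ∂μ := ⟨_, rfl⟩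
    obtain ⟨A, hA⟩ : ∃ A : ℝ, A = ∫ x, Q x * Real.exp (q * Q x) ∂μ := ⟨_, rfl⟩
    obtain ⟨B, hB⟩ : ∃ B : ℝ, B = ∫ x, D x ^ 2 * Real.exp (q * Q x) ∂μ := ⟨_, rfl⟩
    rw [← hΛ, ← hΛ']
    have hΛge : E₀⁻¹ ≤ Λ := by
      rw [hΛ]
      calc E₀⁻¹ = ∫ _x, E₀⁻¹ ∂μ := by rw [integral_const, probReal_univ, one_smul]
        _ ≤ ∫ x, Real.exp (q * Q x) ∂μ := integral_mono (integrable_const _) hEi hexp_ge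
    have hΛ'0 : 0 < Λ' := by
      rw [hΛ']
      have hc0 : 0 < Real.exp (-(qT * Mf)) := Real.exp_pos _
      calc (0 : ℝ) < ∫ _x, Real.exp (-(qT * Mf)) ∂μ := by rw [integral_const, probReal_univ, one_smul]; exact hc0
        _ ≤ ∫ x, Real.exp (q' * Q' x) ∂μ := integral_mono (integrable_const _) hE'i fun x => Real.exp_le_exp.2 (by
            have h1 : q' * (-Mf) ≤ q' * Q' x := mul_le_mul_of_nonneg_left (hQ'ge x) hq'0.le
            have h2 : q' * Mf ≤ qT * Mf := mul_le_mul_of_nonneg_right hq'T hMf0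
            linarith)
    have hBle : B ≤ (2 * t * Lf) ^ 2 * Λ := by
      rw [hB, hΛ, ← integral_const_mul]
      exact integral_mono hBi (hEi.const_mul _) fun x => mul_le_mul_of_nonneg_right (pow_le_pow_left₀ (hD0 x) (hDle x) 2) (Real.exp_pos _).le
    -- the integrated exponential step
    have hpt : ∀ x, Real.exp (q' * Q' x) ≤ Real.exp (q * Q x) * (1 + ((δ / C) * Q x - q' * δ * D x ^ 2 / (2 * t * t'))) + E₀ * (h₀ ^ 2 * δ ^ 2) := by
      intro x
      have htime : Q' x ≤ Q x - δ / (2 * t * t') * D x ^ 2 := by rw [hQ'w, hQw, hDw, hδ]; exact hopfLax_time_le hf ht htt' x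
      have hexp1 : q' * Q' x ≤ q * Q x + ((δ / C) * Q x - q' * δ * D x ^ 2 / (2 * t * t')) := by
        have h1 := mul_le_mul_of_nonneg_left htime hq'0.le
        have hqq' : q' - q = δ / C := by rw [hq, hq', hδ]; field_simp; ring
        have e : q' * (Q x - δ / (2 * t * t') * D x ^ 2) = q * Q x + ((q' - q) * Q x - q' * δ * D x ^ 2 / (2 * t * t')) := by ring
        rw [e, hqq'] at h1; exact h1
      have hhb : |(δ / C) * Q x - q' * δ * D x ^ 2 / (2 * t * t')| ≤ δ * h₀ := by
        rw [hh₀]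
        have h1 : |(δ / C) * Q x| ≤ δ * (Mf / C) := by
          rw [abs_mul, abs_of_nonneg (div_nonneg hδ0 hC.le)]
          have : |Q x| ≤ Mf := abs_le.2 ⟨hQge x, hQle x⟩
          calc δ / C * |Q x| ≤ δ / C * Mf := mul_le_mul_of_nonneg_left this (div_nonneg hδ0 hC.le)
            _ = δ * (Mf / C) := by ring
        have h2 : 0 ≤ q' * δ * D x ^ 2 / (2 * t * t') := by positivity
        have h3 : q' * δ * D x ^ 2 / (2 * t * t') ≤ δ * (2 * qT * Lf ^ 2) := by
          rw [div_le_iff₀ (by positivity)]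
          have hD2 : D x ^ 2 ≤ (2 * t * Lf) ^ 2 := pow_le_pow_left₀ (hD0 x) (hDle x) 2
          have hqT0 : 0 ≤ qT := hq'0.le.trans hq'T
          have h4 : q' * δ * D x ^ 2 ≤ qT * δ * (2 * t * Lf) ^ 2 :=
            mul_le_mul (mul_le_mul_of_nonneg_right hq'T hδ0) hD2 (sq_nonneg _) (mul_nonneg hqT0 hδ0)
          have h5 : qT * δ * (2 * t * Lf) ^ 2 = δ * (2 * qT * Lf ^ 2) * (2 * t * t) := by ring
          have h6 : δ * (2 * qT * Lf ^ 2) * (2 * t * t) ≤ δ * (2 * qT * Lf ^ 2) * (2 * t * t') :=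
            mul_le_mul_of_nonneg_left (by nlinarith) (mul_nonneg hδ0 (mul_nonneg (mul_nonneg zero_le_two hqT0) (sq_nonneg _)))
          linarith
        have h1' := abs_le.1 h1
        rw [abs_le]
        constructor
        · linarith [h1'.1, h3]
        · linarith [h1'.2, h2]
      exact exp_step_pointwise hexp1 hhb hδh (hexp_le x)
    have hΛ'le : Λ' ≤ Λ + (δ / C) * A - (q' * δ / (2 * t * t')) * B + E₀ * (h₀ ^ 2 * δ ^ 2) := by
      have h1 : Λ' ≤ ∫ x, (Real.exp (q * Q x) * (1 + ((δ / C) * Q x - q' * δ * D x ^ 2 / (2 * t * t'))) + E₀ * (h₀ ^ 2 * δ ^ 2)) ∂μ := by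
        rw [hΛ']; exact integral_mono hE'i (hhm.add (integrable_const _)) hpt
      have h2 : ∫ x, (Real.exp (q * Q x) * (1 + ((δ / C) * Q x - q' * δ * D x ^ 2 / (2 * t * t'))) + E₀ * (h₀ ^ 2 * δ ^ 2)) ∂μ =
          Λ + (δ / C) * A - (q' * δ / (2 * t * t')) * B + E₀ * (h₀ ^ 2 * δ ^ 2) := by
        rw [integral_add hhm (integrable_const _), integral_const, probReal_univ, one_smul]
        have e : (fun x => Real.exp (q * Q x) * (1 + ((δ / C) * Q x - q' * δ * D x ^ 2 / (2 * t * t')))) =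
            fun x => (Real.exp (q * Q x) + (δ / C) * (Q x * Real.exp (q * Q x))) - (q' * δ / (2 * t * t')) * (D x ^ 2 * Real.exp (q * Q x)) := by
          funext x; ring
        have hsum : Integrable (fun x => Real.exp (q * Q x) + δ / C * (Q x * Real.exp (q * Q x))) μ := hEi.add (hAi.const_mul _)
        rw [e, integral_sub hsum (hBi.const_mul _), integral_add hEi (hAi.const_mul _),
          integral_const_mul, integral_const_mul, ← hΛ, ← hA, ← hB]
      linarith
    -- the LSI at the exact slope
    have hLSI : A - Λ / q * Real.log Λ ≤ C * q / (2 * t ^ 2) * B := by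
      have h := hopfLax_entropy_le μ hLS hf hLf hlip ht hq0.le
      simp only [← hQw, ← hDw] at h
      have h' : ∫ x, (q * Q x) * Real.exp (q * Q x) ∂μ - Λ * Real.log Λ ≤ C * q ^ 2 / (2 * t ^ 2) * B := by
        rw [hΛ, hB]; exact h
      have hqA : ∫ x, (q * Q x) * Real.exp (q * Q x) ∂μ = q * A := by
        rw [hA, ← integral_const_mul]; exact integral_congr_ae (ae_of_all _ fun x => by ring)
      rw [hqA] at h'
      have hΛ0 : 0 < Λ := lt_of_lt_of_le (inv_pos.2 hE₀0) hΛge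
      have h'' := div_le_div_of_nonneg_right h' hq0.le
      have e1 : (q * A - Λ * Real.log Λ) / q = A - Λ / q * Real.log Λ := by field_simp
      have e2 : C * q ^ 2 / (2 * t ^ 2) * B / q = C * q / (2 * t ^ 2) * B := by field_simp
      rw [e1, e2] at h''; exact h''
    have hB0 : 0 ≤ B := by rw [hB]; exact integral_nonneg fun x => mul_nonneg (sq_nonneg _) (Real.exp_pos _).le
    exact laplace_step_algebra hC ha ht₀ ht₀t htt' hq hq' hδ hE₀0 hΛge hΛ'0 hB0 hBle hΛ'le hLSI
  -- translate back
  have e1 : (fun x => Real.exp ((a + t' / C) * ⨅ v, (f v + dist x v ^ 2 / (2 * t')))) = fun x => Real.exp (q' * Q' x) := by funext x; rw [hq', hQ'w]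
  have e2 : (fun x => Real.exp ((a + t / C) * ⨅ v, (f v + dist x v ^ 2 / (2 * t)))) = fun x => Real.exp (q * Q x) := by funext x; rw [hq, hQw]
  rw [e1, e2, ← hq, ← hq', ← hqT, ← hh₀, ← hE₀, ← hδ]
  exact hgoal

end Summit.QuantumFields.YangMills.Theorems.ColdStartUniversality

end
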